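import Literature.AlgebraicGeometry.HodgeTheory.HarmonicProjectorTransportContinuousDep
import Literature.AlgebraicGeometry.HodgeTheory.HarmonicFiltrationOperator
import Literature.Geometry.Kaehler.ChartBallL2ComparisonDep
import Literature.Geometry.Kaehler.DiffeomorphDeRhamCohomology
import HarnessLib

/-!
# The continuous family of harmonic projectors over the chart ball and its kernel, the Hodge filtration — DEPENDENT fibre
# diffeomorphisms (Voisin I §10.2.2 — step K1 of the discharge of Griffiths' holomorphy of the Hodge bundles)

Layer `Literature/AlgebraicGeometry/HodgeTheory`; one theorem (+ a private functoriality lemma), no definition, no named fact.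
Prover seat `hodge-nonav-19716-p2` (g11, cell `hodge-nonav`), brick **K1-3a** of prover-Bx's programme «GRIFFITHS-HOLOMORPHY»
in the form its consumer (K7) can apply: `HarmonicProjectorFamilyContinuous.exists_continuousOn_harmonicProjector_family` takes a
TOTAL family `e : ∀ p : EB, X s₀ ≅ X (c⁻¹ p)`, but clause (4) of `IsProperHolomorphicSubmersion.exists_chartBall_trivialisation`
(the only producer) gives `∀ p ∈ ball, ∃ e, …`, i.e. after `choose` a DEPENDENT family `e : ∀ p ∈ ball (c s₀) r, X s₀ ≅ X (c⁻¹ p)`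
— and a total one does not exist in general (the junk fibres need not be diffeomorphic to `X s₀`).  This file re-proves the
theorem with the dependent binders `(e : ∀ p ∈ ball (c s₀) r, …)`, `(he : ∀ p (hp : p ∈ ball) x, ι (c⁻¹ p) (e p hp x) = Φ p x)`.
The outputs `o : ∀ z : EB, …` (orientation fields; junk off the ball) and `L : EB → (H^k_dR(X s₀) →ₗ A^k(X s₀))` (zero off the
ball) stay TOTAL; `hrm z hz` is dependent as before; every property is asserted for `z ∈ ball (c s₀) r` and feeds `e z hz`.
* **`exists_continuousOn_harmonicProjector_family_dep`** — orientations `o z` (transported from `o₀` along `e z hz`, smooth volume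
  forms on the ball), a radius `0 < r₁ ≤ r`, harmonic-representative maps `hrm z hz` (`exists_harmonicRep_linearMap`), and
  `L z c = e^* (Π^{<p} η^{(z)})`, `η^{(z)} = hrm z hz ((e⁻¹)^* c)`, `e = e z hz`, with (kernel) `ker (L z) = e^* (F^p H^k(X (c⁻¹ z)))`,
  `F^p = ⨆_{r ≥ p} K^{r,k-r}`, and (continuity) `z ↦ L z c` continuous on `ball (c s₀) r₁` for every `c`.  Proof = the proof of
  `exists_continuousOn_harmonicProjector_family`, fed `exists_radius_re_cl2Inner_pullback_le_dep` and
  `continuousAt_transported_harmonicProjector_dep`.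
HONEST FRAMING: an analytic brick; nothing here says HC or any rung is proved.

## References
* [VoisinHodgeI2002] C. Voisin, Hodge Theory and Complex Algebraic Geometry I (2002), §5.3.1 Thm. 5.23, §6.1.3 Prop. 6.11, §9.3.2, §10.2.2.
* [Kodaira2005] K. Kodaira, Complex Manifolds and Deformation of Complex Structures, §7.2 Thm. 7.3.
-/

noncomputable section

open scoped Manifold ContDiff Topology InnerProductSpace
open Bundle Module Set Filter Function Metric Finset
open Literature.Geometry.Kaehler Literature.Geometry.Manifold Literature.NumberTheory.Transcendental
  Literature.AlgebraicGeometry.Motives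

namespace Literature.AlgebraicGeometry.HodgeTheory

-- The identification `TangentSpace I x = E` is an abuse of definitional equality; as in the tree's
-- tangent-bundle files we let `isDefEq` unfold it.
set_option backward.isDefEq.respectTransparency false

universe u

section Orientation

/-- Functoriality of the transport of orientations: `map f (map e x) = map (e ≪≫ f) x`. [cite: LeeSmoothManifolds2013, Prop. 15.5] -/
private theorem orientation_map_map_dep {R : Type*} [CommRing R] [PartialOrder R] [IsStrictOrderedRing R] {M N P : Type*}
    [AddCommGroup M] [Module R M] [AddCommGroup N] [Module R N] [AddCommGroup P] [Module R P] {ι : Type*}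
    (e : M ≃ₗ[R] N) (f : N ≃ₗ[R] P) (x : Orientation R M ι) :
    Orientation.map ι f (Orientation.map ι e x) = Orientation.map ι (e.trans f) x := by
  induction x using Module.Ray.ind with
  | h v hv => simp only [Orientation.map_apply]; rfl

end Orientation

section ChartBall

variable {EX : Type u} [NormedAddCommGroup EX] [NormedSpace ℂ EX] [FiniteDimensional ℂ EX]
  [MeasurableSpace EX] [BorelSpace EX]
  {E𝒳 : Type u} [NormedAddCommGroup E𝒳] [NormedSpace ℂ E𝒳] [FiniteDimensional ℂ E𝒳]
  {𝒳 : Type u} [TopologicalSpace 𝒳] [ChartedSpace E𝒳 𝒳] [IsManifold 𝓘(ℂ, E𝒳) ω 𝒳]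
  [IsManifold 𝓘(ℝ, E𝒳) ∞ 𝒳]
  {EB : Type u} [NormedAddCommGroup EB] [NormedSpace ℂ EB]
  {B : Type u} [TopologicalSpace B] [ChartedSpace EB B]
  {proj : 𝒳 → B}
  (G : ContMDiffRiemannianMetric 𝓘(ℝ, E𝒳) ∞ E𝒳 (fun y : 𝒳 ↦ TangentSpace 𝓘(ℝ, E𝒳) y))
  {X : B → Type u} [∀ b, TopologicalSpace (X b)] [∀ b, ChartedSpace EX (X b)]
  [∀ b, IsManifold 𝓘(ℂ, EX) ω (X b)] [∀ b, IsManifold 𝓘(ℝ, EX) ∞ (X b)]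
  [∀ b, CompactSpace (X b)] [∀ b, T2Space (X b)]
  {ι : ∀ b, X b → 𝒳}

set_option maxHeartbeats 1600000 in
/-- **The continuous family of harmonic projectors over the chart ball and its kernel, dependent fibre diffeomorphisms**
(`exists_continuousOn_harmonicProjector_family` with `e : ∀ p ∈ ball, …` as produced by clause (4) of
`exists_chartBall_trivialisation`; see the module docstring).
[cite: VoisinHodgeI2002, §10.2.2 and §9.3.2 Prop. 9.20] [cite: Kodaira2005, §7.2 Thm. 7.3] -/
theorem exists_continuousOn_harmonicProjector_family_dep {O : Set B} (hι : ∀ b ∈ O, IsFibreEmbedding EX E𝒳 proj b (ι b))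
    (g : ∀ b, ContMDiffRiemannianMetric 𝓘(ℝ, EX) ∞ EX (fun x : X b ↦ TangentSpace 𝓘(ℝ, EX) x))
    (hg : ∀ b ∈ O, ∀ (x : X b) (v w : TangentSpace 𝓘(ℝ, EX) x), (g b).inner x v w =
      G.inner (ι b x) (mfderiv 𝓘(ℝ, EX) 𝓘(ℝ, E𝒳) (ι b) x v) (mfderiv 𝓘(ℝ, EX) 𝓘(ℝ, E𝒳) (ι b) x w))
    (hgK : ∀ b ∈ O, (g b).toRiemannianMetric.IsKaehler)
    {s₀ : B} {r : ℝ} {Φ : EB → X s₀ → 𝒳}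
    (hbO : ∀ p ∈ ball (extChartAt 𝓘(ℂ, EB) s₀ s₀) r, (extChartAt 𝓘(ℂ, EB) s₀).symm p ∈ O)
    (hΦs : ContMDiffOn (𝓘(ℝ, EB).prod 𝓘(ℝ, EX)) 𝓘(ℝ, E𝒳) ∞ (uncurry Φ)
      (ball (extChartAt 𝓘(ℂ, EB) s₀ s₀) r ×ˢ univ))
    (e : ∀ p ∈ ball (extChartAt 𝓘(ℂ, EB) s₀ s₀) r, X s₀ ≃ₘ^∞⟮𝓘(ℝ, EX), 𝓘(ℝ, EX)⟯ X ((extChartAt 𝓘(ℂ, EB) s₀).symm p))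
    (he : ∀ p (hp : p ∈ ball (extChartAt 𝓘(ℂ, EB) s₀ s₀) r), ∀ x,
      ι ((extChartAt 𝓘(ℂ, EB) s₀).symm p) (e p hp x) = Φ p x)
    (hs₀ : s₀ ∈ O) (hΦ0 : ∀ x, Φ (extChartAt 𝓘(ℂ, EB) s₀ s₀) x = ι s₀ x) (hr : 0 < r)
    {N : ℕ} [Fact (finrank ℝ EX = N)] (hN : 0 < N)
    (o₀ : (x : X s₀) → Orientation ℝ (TangentSpace 𝓘(ℝ, EX) x) (Fin N)) {k m : ℕ} (hkm : k + m = N) (p : ℕ) :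
    letI : ∀ b', RiemannianBundle (fun x : X b' ↦ TangentSpace 𝓘(ℝ, EX) x) := fun b' ↦ ⟨(g b').toRiemannianMetric⟩
    ∀ (ho₀ : IsSmoothForm (riemannianVolumeForm o₀))
      (b : ∀ x : X s₀, OrthonormalBasis (Fin N) ℝ (TangentSpace 𝓘(ℝ, EX) x)), (∀ x, (b x).toBasis.orientation = o₀ x) →
    haveI : Fact (IsSmoothForm (riemannianVolumeForm o₀)) := ⟨ho₀⟩
    ∃ (o : ∀ z : EB, (y : X ((extChartAt 𝓘(ℂ, EB) s₀).symm z)) → Orientation ℝ (TangentSpace 𝓘(ℝ, EX) y) (Fin N))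
      (r₁ : ℝ)
      (hrm : ∀ z, z ∈ ball (extChartAt 𝓘(ℂ, EB) s₀ s₀) r →
        complexDeRhamCohomology EX (X ((extChartAt 𝓘(ℂ, EB) s₀).symm z)) k →ₗ[ℂ]
          ↥(cclosedSmoothForms EX (X ((extChartAt 𝓘(ℂ, EB) s₀).symm z)) k))
      (L : EB → (complexDeRhamCohomology EX (X s₀) k →ₗ[ℂ] CL2SmoothForms o₀ k)),
      (∀ z (hz : z ∈ ball (extChartAt 𝓘(ℂ, EB) s₀ s₀) r) x,
        Orientation.map (Fin N) ((e z hz).mfderivToContinuousLinearEquiv (by simp) x).toLinearEquiv (o₀ x) = o z (e z hz x)) ∧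
      (∀ z ∈ ball (extChartAt 𝓘(ℂ, EB) s₀ s₀) r, IsSmoothForm (riemannianVolumeForm (o z))) ∧ 0 < r₁ ∧ r₁ ≤ r ∧
      (∀ z (hz : z ∈ ball (extChartAt 𝓘(ℂ, EB) s₀ s₀) r) c',
        IsCHarmonicForm (o z) hkm (hrm z hz c' : MForm 𝓘(ℝ, EX) (X ((extChartAt 𝓘(ℂ, EB) s₀).symm z)) ℂ k) ∧
          complexDeRhamCohomology.mk EX (X ((extChartAt 𝓘(ℂ, EB) s₀).symm z)) k (hrm z hz c') = c') ∧
      (∀ z (hz : z ∈ ball (extChartAt 𝓘(ℂ, EB) s₀ s₀) r) (c : complexDeRhamCohomology EX (X s₀) k),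
        CL2SmoothForms.toForm o₀ (L z c) =
          (∑ pq ∈ (antidiagonal k).filter (fun pq ↦ pq.1 < p),
            (hrm z hz (complexDeRhamCohomology.map EX (e z hz).symm.contMDiff k c) :
              MForm 𝓘(ℝ, EX) (X ((extChartAt 𝓘(ℂ, EB) s₀).symm z)) ℂ k).typeComponent pq.1 pq.2).pullback 𝓘(ℝ, EX) (e z hz)) ∧
      (∀ z (hz : z ∈ ball (extChartAt 𝓘(ℂ, EB) s₀ s₀) r),
        LinearMap.ker (L z) = Submodule.map (complexDeRhamCohomology.map EX (e z hz).contMDiff k)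
          (⨆ pq ∈ {pq ∈ antidiagonal k | p ≤ pq.1}, hodgePQ EX (X ((extChartAt 𝓘(ℂ, EB) s₀).symm z)) k pq.1 pq.2)) ∧
      (∀ c, ContinuousOn (fun z ↦ L z c) (ball (extChartAt 𝓘(ℂ, EB) s₀ s₀) r₁)) := by
  letI iX : ∀ b', RiemannianBundle (fun x : X b' ↦ TangentSpace 𝓘(ℝ, EX) x) := fun b' ↦ ⟨(g b').toRiemannianMetric⟩
  intro ho₀ b hb
  haveI hF₀ : Fact (IsSmoothForm (riemannianVolumeForm o₀)) := ⟨ho₀⟩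
  haveI : ∀ b', IsContMDiffRiemannianBundle 𝓘(ℝ, EX) ∞ EX (fun x : X b' ↦ TangentSpace 𝓘(ℝ, EX) x) :=
    fun b' ↦ ⟨(g b').inner, (g b').contMDiff, fun _ _ _ ↦ rfl⟩
  haveI : FiniteDimensional ℝ EX := FiniteDimensional.complexToReal EX
  haveI : Nonempty (Fin N) := ⟨⟨0, hN⟩⟩
  have hEX : finrank ℝ EX = N := Fact.out
  classical
  -- ### (D) orientations of the fibres and the small ball (`ChartBallL2Comparison`)
  obtain ⟨o, hΦo, ho, r₁, hr₁, hr₁r, hcmp⟩ :=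
    exists_radius_re_cl2Inner_pullback_le_dep G hι g hg hbO hΦs e he hs₀ hΦ0 hr o₀ k ho₀ b hb
  have hballr : ball (extChartAt 𝓘(ℂ, EB) s₀ s₀) r₁ ⊆ ball (extChartAt 𝓘(ℂ, EB) s₀ s₀) r := ball_subset_ball hr₁r
  have hFz : ∀ z (hz : z ∈ ball (extChartAt 𝓘(ℂ, EB) s₀ s₀) r), Fact (IsSmoothForm (riemannianVolumeForm (o z))) :=
    fun z hz ↦ ⟨ho z hz⟩
  -- ### harmonic representatives and the operators `Λ_z` on the fibres over the ball
  have hHR : ∀ z (hz : z ∈ ball (extChartAt 𝓘(ℂ, EB) s₀ s₀) r),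
      haveI := hFz z hz
      ∃ (hr' : complexDeRhamCohomology EX (X ((extChartAt 𝓘(ℂ, EB) s₀).symm z)) k →ₗ[ℂ]
          ↥(cclosedSmoothForms EX (X ((extChartAt 𝓘(ℂ, EB) s₀).symm z)) k))
        (Λ : complexDeRhamCohomology EX (X ((extChartAt 𝓘(ℂ, EB) s₀).symm z)) k →ₗ[ℂ] CL2SmoothForms (o z) k),
        (∀ c, IsCHarmonicForm (o z) hkm (hr' c : MForm 𝓘(ℝ, EX) (X ((extChartAt 𝓘(ℂ, EB) s₀).symm z)) ℂ k)) ∧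
        (∀ c, complexDeRhamCohomology.mk EX _ k (hr' c) = c) ∧
        (∀ c, CL2SmoothForms.toForm (o z) (Λ c) = ∑ pq ∈ (antidiagonal k).filter (fun pq ↦ pq.1 < p),
          (hr' c : MForm 𝓘(ℝ, EX) (X ((extChartAt 𝓘(ℂ, EB) s₀).symm z)) ℂ k).typeComponent pq.1 pq.2) ∧
        (∀ c, Λ c = 0 ↔ c ∈ ⨆ pq ∈ {pq ∈ antidiagonal k | p ≤ pq.1}, hodgePQ EX (X ((extChartAt 𝓘(ℂ, EB) s₀).symm z)) k pq.1 pq.2) := by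
    intro z hz
    haveI := hFz z hz
    obtain ⟨hr', Λ, hharm, hmk, -, hΛ, hker⟩ :=
      exists_harmonicRep_linearMap (g ((extChartAt 𝓘(ℂ, EB) s₀).symm z)) (o z) (hgK _ (hbO z hz)) hkm p (ho z hz)
    exact ⟨hr', Λ, hharm, hmk, hΛ, hker⟩
  choose hrm Λ hharm hmk hΛ hker using hHR
  -- ### the transfer maps `P_z : A^k(X (c⁻¹ z)) → A^k(X s₀)`, `w ↦ e_z^* w`, and the family `L`
  have hPex : ∀ z (hz : z ∈ ball (extChartAt 𝓘(ℂ, EB) s₀ s₀) r),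
      haveI := hFz z hz
      ∃ P : CL2SmoothForms (o z) k →ₗ[ℂ] CL2SmoothForms o₀ k,
        ∀ w, CL2SmoothForms.toForm o₀ (P w) = (CL2SmoothForms.toForm (o z) w).pullback 𝓘(ℝ, EX) (e z hz) := by
    intro z hz
    haveI := hFz z hz
    refine ⟨{ toFun := fun w ↦ CL2SmoothForms.mk o₀ ((CL2SmoothForms.toForm (o z) w).pullback 𝓘(ℝ, EX) (e z hz))
                (isSmoothForm_pullback (e z hz).contMDiff (CL2SmoothForms.isSmoothForm_toForm (o z) w))
              map_add' := fun a b ↦ Subtype.ext rfl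
              map_smul' := fun a w ↦ Subtype.ext rfl }, fun w ↦ rfl⟩
  choose P hP using hPex
  set L : EB → (complexDeRhamCohomology EX (X s₀) k →ₗ[ℂ] CL2SmoothForms o₀ k) := fun z ↦
    if hz : z ∈ ball (extChartAt 𝓘(ℂ, EB) s₀ s₀) r then
      haveI := hFz z hz
      P z hz ∘ₗ Λ z hz ∘ₗ complexDeRhamCohomology.map EX (e z hz).symm.contMDiff k
    else 0 with hLdef
  have hL : ∀ z (hz : z ∈ ball (extChartAt 𝓘(ℂ, EB) s₀ s₀) r) (c : complexDeRhamCohomology EX (X s₀) k),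
      CL2SmoothForms.toForm o₀ (L z c) =
        (∑ pq ∈ (antidiagonal k).filter (fun pq ↦ pq.1 < p),
          (hrm z hz (complexDeRhamCohomology.map EX (e z hz).symm.contMDiff k c) :
            MForm 𝓘(ℝ, EX) (X ((extChartAt 𝓘(ℂ, EB) s₀).symm z)) ℂ k).typeComponent pq.1 pq.2).pullback 𝓘(ℝ, EX) (e z hz) := by
    intro z hz c
    haveI := hFz z hz
    simp only [hLdef, dif_pos hz]
    rw [LinearMap.comp_apply, LinearMap.comp_apply, hP, hΛ]
  refine ⟨o, r₁, hrm, L, hΦo, ho, hr₁, hr₁r, fun z hz c' ↦ ⟨hharm z hz c', hmk z hz c'⟩, hL, ?_, ?_⟩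
  · -- ### the kernel
    intro z hz
    haveI := hFz z hz
    have hPinj : ∀ w, P z hz w = 0 → w = 0 := by
      intro w hw
      have h1 : (CL2SmoothForms.toForm (o z) w).pullback 𝓘(ℝ, EX) (e z hz) = 0 := by
        rw [← hP z hz w, hw]; rfl
      apply Subtype.ext
      change CL2SmoothForms.toForm (o z) w = 0
      have h2 : ((CL2SmoothForms.toForm (o z) w).pullback 𝓘(ℝ, EX) (e z hz)).pullback 𝓘(ℝ, EX) (e z hz).symm =
          CL2SmoothForms.toForm (o z) w := by
        rw [← MForm.pullback_comp ((e z hz).mdifferentiable (by simp)) ((e z hz).symm.mdifferentiable (by simp))]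
        have : (((e z hz) : X s₀ → _) ∘ ((e z hz).symm : _ → X s₀)) = id := funext fun y ↦ (e z hz).apply_symm_apply y
        rw [this, MForm.pullback_id]
      rw [← h2, h1]
      exact MForm.pullback_zero _
    ext c
    rw [LinearMap.mem_ker]
    constructor
    · intro hc
      have h1 : P z hz (Λ z hz (complexDeRhamCohomology.map EX (e z hz).symm.contMDiff k c)) = 0 := by
        simpa only [hLdef, dif_pos hz, LinearMap.comp_apply] using hc
      have h2 := (hker z hz _).1 (hPinj _ h1)
      refine ⟨complexDeRhamCohomology.map EX (e z hz).symm.contMDiff k c, h2, ?_⟩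
      exact complexDeRhamCohomology.map_apply_map_symm (e z hz) k c
    · rintro ⟨w, hw, rfl⟩
      have h1 : complexDeRhamCohomology.map EX (e z hz).symm.contMDiff k (complexDeRhamCohomology.map EX (e z hz).contMDiff k w) = w :=
        complexDeRhamCohomology.map_symm_apply_map (e z hz) k w
      simp only [hLdef, dif_pos hz, LinearMap.comp_apply, h1, (hker z hz w).2 hw, map_zero]
  · -- ### continuity on the small ball
    intro c z₂ hz₂
    have hz₂r : z₂ ∈ ball (extChartAt 𝓘(ℂ, EB) s₀ s₀) r := hballr hz₂
    -- an oriented orthonormal frame field of `X (c⁻¹ z₂)`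
    set b₂ : ∀ x : X ((extChartAt 𝓘(ℂ, EB) s₀).symm z₂), OrthonormalBasis (Fin N) ℝ (TangentSpace 𝓘(ℝ, EX) x) := fun x ↦
      ((stdOrthonormalBasis ℝ (TangentSpace 𝓘(ℝ, EX) x)).reindex (finCongr hEX)).adjustToOrientation (o z₂ x) with hb₂def
    have hb₂ : ∀ x, (b₂ x).toBasis.orientation = o z₂ x := fun x ↦ OrthonormalBasis.orientation_adjustToOrientation _ _
    -- orientation compatibility of the transitions `(e z₂ hz₂r)⁻¹ ≫ e z`
    have hΨo : ∀ z (hz : z ∈ ball (extChartAt 𝓘(ℂ, EB) s₀ s₀) r), ∀ x,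
        Orientation.map (Fin N)
            (((e z₂ hz₂r).symm.trans (e z hz)).mfderivToContinuousLinearEquiv (by simp) x).toLinearEquiv (o z₂ x) =
          o z (((e z₂ hz₂r).symm.trans (e z hz)) x) := by
      intro z hz x
      obtain ⟨y, rfl⟩ : ∃ y, e z₂ hz₂r y = x := ⟨(e z₂ hz₂r).symm x, (e z₂ hz₂r).apply_symm_apply x⟩
      set Ψ := (e z₂ hz₂r).symm.trans (e z hz) with hΨ
      -- orientations as functions into a fixed type
      let oz : X ((extChartAt 𝓘(ℂ, EB) s₀).symm z) → Orientation ℝ EX (Fin N) := fun y' ↦ o z y'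
      let oz₂ : X ((extChartAt 𝓘(ℂ, EB) s₀).symm z₂) → Orientation ℝ EX (Fin N) := fun y' ↦ o z₂ y'
      have hΨy : Ψ (e z₂ hz₂r y) = e z hz y := by simp [hΨ, Diffeomorph.coe_trans]
      -- the chain rule: `DΨ (e z₂ hz₂r y) ∘ D(e z₂ hz₂r) y = D(e z hz) y`
      have hchain : ((e z₂ hz₂r).mfderivToContinuousLinearEquiv (by simp) y).toLinearEquiv.trans
          (Ψ.mfderivToContinuousLinearEquiv (by simp) (e z₂ hz₂r y)).toLinearEquiv =
            ((show TangentSpace 𝓘(ℝ, EX) y ≃L[ℝ] TangentSpace 𝓘(ℝ, EX) (Ψ (e z₂ hz₂r y)) from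
              (e z hz).mfderivToContinuousLinearEquiv (by simp) y).toLinearEquiv) := by
        apply LinearEquiv.ext
        intro v
        change (Ψ.mfderivToContinuousLinearEquiv (by simp) (e z₂ hz₂r y)) (((e z₂ hz₂r).mfderivToContinuousLinearEquiv (by simp) y) v) =
          ((e z hz).mfderivToContinuousLinearEquiv (by simp) y) v
        have a1 : ∀ w, ((e z₂ hz₂r).mfderivToContinuousLinearEquiv (by simp) y) w = mfderiv 𝓘(ℝ, EX) 𝓘(ℝ, EX) (e z₂ hz₂r) y w :=
          fun w ↦ by rw [← ContinuousLinearEquiv.coe_coe, Diffeomorph.mfderivToContinuousLinearEquiv_coe]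
        have a2 : ∀ w, (Ψ.mfderivToContinuousLinearEquiv (by simp) (e z₂ hz₂r y)) w = mfderiv 𝓘(ℝ, EX) 𝓘(ℝ, EX) Ψ (e z₂ hz₂r y) w :=
          fun w ↦ by rw [← ContinuousLinearEquiv.coe_coe, Diffeomorph.mfderivToContinuousLinearEquiv_coe]
        have a3 : ∀ w, ((e z hz).mfderivToContinuousLinearEquiv (by simp) y) w = mfderiv 𝓘(ℝ, EX) 𝓘(ℝ, EX) (e z hz) y w :=
          fun w ↦ by rw [← ContinuousLinearEquiv.coe_coe, Diffeomorph.mfderivToContinuousLinearEquiv_coe]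
        rw [a1, a2, a3]
        have hc := mfderiv_comp y (Ψ.mdifferentiable (by simp) (e z₂ hz₂r y)) ((e z₂ hz₂r).mdifferentiable (by simp) y)
        have hfun : ((Ψ : _ → _) ∘ ((e z₂ hz₂r) : X s₀ → _)) = ((e z hz) : X s₀ → _) := by
          funext y'; simp [hΨ, Diffeomorph.coe_trans]
        rw [hfun] at hc
        rw [hc]
        rfl
      change Orientation.map (Fin N) (Ψ.mfderivToContinuousLinearEquiv (by simp) (e z₂ hz₂r y)).toLinearEquiv (oz₂ (e z₂ hz₂r y)) =
        oz (Ψ (e z₂ hz₂r y))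
      have h1 : oz₂ (e z₂ hz₂r y) = Orientation.map (Fin N) ((e z₂ hz₂r).mfderivToContinuousLinearEquiv (by simp) y).toLinearEquiv (o₀ y) :=
        (hΦo z₂ hz₂r y).symm
      have h2 : oz (e z hz y) = Orientation.map (Fin N) ((e z hz).mfderivToContinuousLinearEquiv (by simp) y).toLinearEquiv (o₀ y) :=
        (hΦo z hz y).symm
      rw [h1, hΨy, h2, orientation_map_map_dep, hchain]
    exact (continuousAt_transported_harmonicProjector_dep G hι g hg hgK hbO hΦs e he o₀ o hkm p ho₀ ho hr₁r
      (fun z hz hz₁ α hα ↦ (hcmp z hz hz₁ α hα).1) hz₂ hz₂r b₂ hb₂ hΨo hrm hharm hmk L hL c).continuousWithinAt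

end ChartBall

end Literature.AlgebraicGeometry.HodgeTheory

end
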